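import Summits.CriticalPhenomena.PercolationContinuityZ3.Theorems.Transplant.SqShadowBlocks
import Summits.CriticalPhenomena.PercolationContinuityZ3.Theorems.Transplant.SqShadowRoutePrep
import HarnessLib

/-!
# SQUARE SHADOWS — port of «HexShadowRouting» to the square-shadow interface: THE ROUTING — the local surgery at every good point of `U(ω)` from `LocalLinkage`

builds on p205010 (kernel theorem, internal audit signed; external expert review pending) — NOT used in this file.  Lane `prim-bschramm`, seat `prim-bschramm-p2` (gen 42; class C1b;
memo §148); helper file (`--supports stmt-CriticalPhenomena-4575 --as helper`).  Statements and proofs from the hexagonal twin with `Ψ : SqShadow G` for `Φ : HexShadow G`, sup-norm squares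
`sqBall` for lattice hexagons, and the square clipped blocks `sqBlk z t s = sqBall z 3 ∩ {w₀ ≤ z₀ + t} ∩ {w₁ ≤ z₁ + s}` (clipping at the common right side of `B_{3n}`, `B'_n` and at
the top of the window) for the hexagonal ones.
[cite: DuminilCopinSidoraviciusTassion2016, §2.3 (proof of Fact 2, pp. 6–7)] [cite: NewmanTassionWu2017, §3.2]
-/

noncomputable section

namespace Summit.CriticalPhenomena.PercolationContinuityZ3.Theorems.Transplant

open MeasureTheory Literature.Probability.Percolation Literature.Probability.LatticeModels SimpleGraph Filter
open scoped Classical Topology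

namespace SqShadow

variable {V : Type} {G : SimpleGraph V} {Ψ : SqShadow G} [Countable V]

/-! ## §1 Complements -/

omit [Countable V] in
/-- **A point of `D(z) ∩ B_{3n}` off `Z_n` lies in `RP(z)`** (for `z ∈ B_{3n} ∖ Z_n` off `zBad`). [folklore] -/
theorem mem_RPblk_of {Γ : GlueData} {z : Site 2} (hzbig : z ∈ Ψ.big Γ) (hzZ : z ∉ Ψ.zSeg Γ) (hzb : z ∉ Ψ.zBad Γ) {w : Site 2} (hwD : w ∈ Ψ.Dblk Γ z)
    (hwbig : w ∈ Ψ.big Γ) (hwZ : w ∉ Ψ.zSeg Γ) : w ∈ Ψ.RPblk Γ z := by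
  have hw3 : w ∈ sqBall z 3 := Ψ.Dblk_subset_sqBall Γ z hwD
  rw [Dblk, mem_sqBlk_iff_lin] at hwD
  rw [RPblk, mem_sqBlk_iff_lin]
  rw [mem_big_iff] at hwbig hzbig
  refine ⟨hwD.1, ?_, by unfold sR; omega⟩
  have htD : ((Ψ.tD Γ z : ℕ) : ℤ) = Ψ.centre 0 + 3 * Γ.m - z 0 := by unfold tD; omega
  by_cases ht : Ψ.zTouch Γ z
  · have htR : Ψ.tR Γ z = Ψ.tD Γ z - 1 := by simp [tR, ht]
    rw [htR]
    -- `w` is not on the column line of `Z_n` (all its block points are in `Z_n`), and `z` is not on it either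
    have hall : ∀ w' ∈ sqBall z 3, w' 0 = Ψ.centre 0 + 3 * Γ.m → w' ∈ Ψ.zSeg Γ := by
      intro w' hw' h0; by_contra hnot; exact hzb ⟨ht, w', hw', h0, hnot⟩
    have hw0 : w 0 ≠ Ψ.centre 0 + 3 * Γ.m := fun h0 => hwZ (hall w hw3 h0)
    have hz0 : z 0 ≠ Ψ.centre 0 + 3 * Γ.m := fun h0 => hzZ (hall z (by rw [mem_sqBall_iff_linear]; omega) h0)
    have hpos : 1 ≤ Ψ.tD Γ z := by omega
    have : ((Ψ.tD Γ z - 1 : ℕ) : ℤ) = Ψ.centre 0 + 3 * Γ.m - z 0 - 1 := by omega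
    omega
  · have htR : Ψ.tR Γ z = Ψ.tD Γ z := by simp [tR, ht]
    rw [htR]; omega

/-- **A vertex of `γ_min` over `Z_n` is its last vertex** (no proper prefix of the minimal path ends in `\overline{Z_n}`). [folklore] -/
theorem eq_getLast_of_sh_mem_zSeg (Γ : GlueData) {ω : BondConfig V} (hA : ω ∈ Ψ.evA Γ) {x : V} (hx : x ∈ Ψ.γmin Γ ω) (hxZ : Ψ.sh x ∈ Ψ.zSeg Γ) :
    x = (Ψ.γmin Γ ω).getLast (Ψ.γmin_spec Γ hA).1.ne_nil := by
  obtain ⟨hγO, -⟩ := Ψ.γmin_spec Γ hA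
  have hex : ∃ l, OpenSAP ω (Ψ.lift (Ψ.big Γ)) (Ψ.lift (Ψ.src Γ)) (Ψ.lift (Ψ.zSeg Γ)) l := ⟨_, hγO⟩
  obtain ⟨l₁, l₂, hsplit⟩ := List.append_of_mem hx
  by_cases hl₂ : l₂ = []
  · subst hl₂
    have : Ψ.γmin Γ ω = l₁ ++ [x] := hsplit
    simp only [this, List.getLast_append_of_ne_nil _ (List.cons_ne_nil _ _), List.getLast_singleton]
  · exfalso
    have h := minSAP_prefix_getLast_not_mem (Ψ.lift_big_finite Γ) hex (p := l₁ ++ [x]) (s := l₂)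
      (by change Ψ.γmin Γ ω = _; rw [hsplit]; simp) hl₂ (by simp)
    simp only [List.getLast_append_of_ne_nil _ (List.cons_ne_nil _ _), List.getLast_singleton, mem_lift] at h
    exact h hxZ

omit [Countable V] in
/-- **The sphere lemma**: a vertex over `D(z)` adjacent to a vertex over `B_{3n} ∖ D(z)` lies over `sqRing z 3` (`sqBall z 3 ∩ B_{3n} ⊆ D(z)` and
the shadow is `1`-Lipschitz). [cite: DuminilCopinSidoraviciusTassion2016, §2.3, proof of Fact 2 ("u' and v' … on the boundary of B̄_R(z)")] -/
theorem sh_mem_sqRing_of_adj (Γ : GlueData) (z : Site 2) {x u : V} (hxD : Ψ.sh x ∈ Ψ.Dblk Γ z) (hadj : G.Adj x u) (hubig : Ψ.sh u ∈ Ψ.big Γ)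
    (huD : Ψ.sh u ∉ Ψ.Dblk Γ z) : Ψ.sh x ∈ sqRing z 3 := by
  have hx3 : Ψ.sh x ∈ sqBall z 3 := Ψ.Dblk_subset_sqBall Γ z hxD
  have hu3 : Ψ.sh u ∉ sqBall z 3 := fun h => huD (Ψ.sqBall_inter_big_subset_Dblk Γ z h hubig)
  rw [mem_sqBall_iff_linear] at hx3 hu3
  rw [mem_sqRing_iff_linear, mem_sqBall_iff_linear]
  have h0 := abs_le.1 (Ψ.abs_sh_sub_sh_le_one hadj 0)
  have h1 := abs_le.1 (Ψ.abs_sh_sub_sh_le_one hadj 1)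
  push_cast at hx3 hu3 ⊢
  omega

/-- **The `src'`-side path `σ` from the (P2)-witness** (variant of «HexShadowRoutePrep»'s `exists_sigma_of_mem_U` needing only `sqBall z 1 ∩ B'_n ⊆ D`).
[cite: DuminilCopinSidoraviciusTassion2016, §2.3 (Definition of U(ω), (P2); proof of Fact 2, the path π)] -/
theorem exists_sigma_of_mem_U' (Γ : GlueData) {ω : BondConfig V} {z : Site 2} (hz : z ∈ Ψ.U Γ ω) {D : Set (Site 2)}
    (hD : ∀ q ∈ sqBall z 1, q ∈ Ψ.small Γ → q ∈ D) :
    ∃ (w : V) (σ : List V), σ.head? = some w ∧ Ψ.sh w ∈ D ∧ σ.IsChain (fun a b => s(a, b) ∈ ω ∧ a ≠ b) ∧ (∀ x ∈ σ, Ψ.sh x ∈ Ψ.small Γ) ∧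
      (∀ x ∈ σ, Ψ.sh x ∉ Ψ.γcols Γ ω) ∧ (∀ x ∈ σ.tail, Ψ.sh x ∉ D) ∧ ∀ h : σ ≠ [], σ.getLast h ∈ Ψ.lift (Ψ.src' Γ) := by
  obtain ⟨-, -, x₀, hx₀, s', hs', hπ⟩ := hz
  obtain ⟨π, hπO⟩ := exists_openSAP_of_openConnIn hπ
  have hx₀π : π.head hπO.ne_nil = x₀ := hπO.head_mem hπO.ne_nil
  have hx₀mem : x₀ ∈ π := by rw [← hx₀π]; exact List.head_mem _
  have hx₀D : Ψ.sh x₀ ∈ D := hD _ hx₀ (hπO.subset x₀ hx₀mem).1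
  obtain ⟨l₁, w, σt, hsplit, hwD, hσt⟩ := exists_last_split (p := fun x => Ψ.sh x ∈ D) π ⟨x₀, hx₀mem, hx₀D⟩
  refine ⟨w, w :: σt, rfl, hwD, ?_, ?_, ?_, ?_, ?_⟩
  · have := hπO.chain
    rw [hsplit] at this
    exact (List.isChain_append.1 this).2.1
  · intro x hx
    exact (hπO.subset x (by rw [hsplit]; exact List.mem_append_right _ hx)).1
  · intro x hx
    exact (hπO.subset x (by rw [hsplit]; exact List.mem_append_right _ hx)).2
  · intro x hx
    exact hσt x hx
  · intro h
    have h1 : (w :: σt).getLast h = π.getLast hπO.ne_nil := by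
      simp only [hsplit]
      rw [List.getLast_append_of_ne_nil _ (List.cons_ne_nil _ _)]
    rw [h1]
    have := hπO.last_mem hπO.ne_nil
    rw [Set.mem_singleton_iff] at this
    rw [this]; exact hs'

/-! ## §2 The surgery at a good point of `U(ω)` -/

/-- **THE LOCAL SURGERY EXISTS AT EVERY GOOD POINT OF `U(ω)`, given `LocalLinkage`** (DST 2016, §2.3, proof of Fact 2: the construction of `ω^{(z)}`, as the
data `SqShadow.Surgery` with cleared columns `D(z) ⊆ sqBall z 3`).  Hypotheses: data in range with `m ≥ 7`; `ω ∈ 𝒳` a lattice configuration; `z ∈ U(ω)` off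
the bounded exceptional sets `X₁`, `X₂`, `zBad`, and not within sup-distance `3` of the end of `γ_min(ω)`.  Steps: `u' = E₁`, `v' = E₂` are the first and last
visits of `γ_min` to `D̄(z)` (two distinct visits exist: the successor of the vertex over `z` is over `sqBall z 1 ∩ B_{3n} ⊆ D(z)`; the start is over `S_{3n}`,
disjoint from `D(z)`; the end is excluded), both over `RP(z) ∩ sqRing z 3`; `w'` and `σ` from the `(P2)`-witness; the three paths from `LocalLinkage` with the
order condition from the swap pair; the key condition over `S_{3n}` is vacuous. [cite: DuminilCopinSidoraviciusTassion2016, §2.3, proof of Fact 2 (pp. 6–7)] -/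
theorem exists_surgery_of_localLinkage (hL : Ψ.LocalLinkage) {Γ : GlueData} (hΓ : Ψ.InRange Γ) (hm : 13 ≤ Γ.m) {ω : BondConfig V} (hω : ω ⊆ G.edgeSet)
    (hX : ω ∈ Ψ.evX Γ) {z : Site 2} (hz : z ∈ Ψ.U Γ ω) (hX₁ : z ∉ Ψ.X₁ Γ) (hX₂ : z ∉ Ψ.X₂ Γ) (hzb : z ∉ Ψ.zBad Γ)
    (hfar : ∀ v ∈ (Ψ.γmin Γ ω).getLast?, z ∉ sqBall (Ψ.sh v) 3) :
    ∃ sg : Ψ.Surgery Γ ω, sg.D ⊆ sqBall z 3 := by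
  have hA : ω ∈ Ψ.evA Γ := hX.1.1.1
  obtain ⟨hγO, -⟩ := Ψ.γmin_spec Γ hA
  have hzU := hz
  obtain ⟨hzs, ⟨g, hgγ, hgz⟩, -⟩ := hz
  have hzbig : z ∈ Ψ.big Γ := by rw [← hgz]; exact hγO.subset g hgγ
  set D := Ψ.Dblk Γ z with hDdef
  have hD3 : D ⊆ sqBall z 3 := Ψ.Dblk_subset_sqBall Γ z
  have hDW : D ⊆ Ψ.big Γ ∪ Ψ.small Γ := Dblk_subset_window hΓ hm hzbig hzs hX₁
  have hadj : ∀ {a b : V}, s(a, b) ∈ ω → G.Adj a b := fun h => (SimpleGraph.mem_edgeSet G).1 (hω h)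
  -- `z ∈ D`, `z ∉ Z_n`
  have hz3 : z ∈ sqBall z 3 := by rw [mem_sqBall_iff_linear]; omega
  have hzD : z ∈ D := Ψ.sqBall_inter_big_subset_Dblk Γ z hz3 hzbig
  have hlastD : Ψ.sh ((Ψ.γmin Γ ω).getLast hγO.ne_nil) ∉ D := by
    intro h
    have := hfar ((Ψ.γmin Γ ω).getLast hγO.ne_nil) (by rw [List.getLast?_eq_some_getLast hγO.ne_nil]; rfl)
    exact this (mem_sqBall_comm.1 (hD3 h))
  have hzZ : z ∉ Ψ.zSeg Γ := by
    intro hzZ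
    have hg := Ψ.eq_getLast_of_sh_mem_zSeg Γ hA hgγ (hgz.symm ▸ hzZ)
    apply hlastD
    rw [← hg, hgz]; exact hzD
  -- the head of `γ` is over `S_{3n}`, off `D̄`
  have hheadD : ∀ h : Ψ.γmin Γ ω ≠ [], Ψ.sh ((Ψ.γmin Γ ω).head h) ∉ D := by
    intro h hD
    exact Dblk_disjoint_src hΓ hm hzs hD (hγO.head_mem h)
  -- two distinct vertices of `γ` over `D`: `g` and its successor
  have htwo : ∃ a ∈ Ψ.γmin Γ ω, ∃ b ∈ Ψ.γmin Γ ω, a ≠ b ∧ Ψ.sh a ∈ D ∧ Ψ.sh b ∈ D := by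
    obtain ⟨l₁, l₂, hsplit⟩ := List.append_of_mem hgγ
    have hl₂ : l₂ ≠ [] := by
      rintro rfl
      have : (Ψ.γmin Γ ω).getLast hγO.ne_nil = g := by simp only [hsplit, List.getLast_append_of_ne_nil _ (List.cons_ne_nil _ _), List.getLast_singleton]
      apply hlastD; rw [this, hgz]; exact hzD
    obtain ⟨u, l₂', rfl⟩ := List.exists_cons_of_ne_nil hl₂
    have hch := hγO.chain
    rw [hsplit, List.isChain_append] at hch
    have hgu : s(g, u) ∈ ω ∧ g ≠ u := (List.isChain_cons_cons.1 hch.2.1).1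
    have huγ : u ∈ Ψ.γmin Γ ω := by rw [hsplit]; simp
    refine ⟨g, hgγ, u, huγ, hgu.2, hgz.symm ▸ hzD, ?_⟩
    have hu3 : Ψ.sh u ∈ sqBall z 3 := by
      rw [mem_sqBall_iff_linear, ← hgz]
      have h0 := abs_le.1 (Ψ.abs_sh_sub_sh_le_one (hadj hgu.1) 0)
      have h1 := abs_le.1 (Ψ.abs_sh_sub_sh_le_one (hadj hgu.1) 1)
      push_cast; omega
    exact Ψ.sqBall_inter_big_subset_Dblk Γ z hu3 (hγO.subset u huγ)
  -- the decomposition at the first and last visits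
  obtain ⟨p₀, E₁, mid, E₂, s₀, hγeq, hp₀, hs₀, hp₀D, hs₀D, hE₁D, hE₂D⟩ :=
    Ψ.γmin_split_at Γ hA D hheadD (fun h => by simpa using hlastD) htwo
  have hE₁γ : E₁ ∈ Ψ.γmin Γ ω := by rw [hγeq]; simp
  have hE₂γ : E₂ ∈ Ψ.γmin Γ ω := by rw [hγeq]; simp
  have hE₁₂ : E₁ ≠ E₂ := by
    intro h
    have hnd := hγO.nodup
    rw [hγeq, List.nodup_append] at hnd
    have := (List.nodup_cons.1 hnd.2.1).1
    exact this (by rw [h]; simp)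
  -- `E₁`, `E₂` are off `Z_n` (they are not the last vertex)
  have hE₁Z : Ψ.sh E₁ ∉ Ψ.zSeg Γ := by
    intro hZ
    have h := Ψ.eq_getLast_of_sh_mem_zSeg Γ hA hE₁γ hZ
    apply hlastD
    rw [← h]; exact hE₁D
  have hE₂Z : Ψ.sh E₂ ∉ Ψ.zSeg Γ := by
    intro hZ
    have h := Ψ.eq_getLast_of_sh_mem_zSeg Γ hA hE₂γ hZ
    apply hlastD
    rw [← h]; exact hE₂D
  have hE₁big : Ψ.sh E₁ ∈ Ψ.big Γ := hγO.subset E₁ hE₁γ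
  have hE₂big : Ψ.sh E₂ ∈ Ψ.big Γ := hγO.subset E₂ hE₂γ
  have hE₁RP : Ψ.sh E₁ ∈ Ψ.RPblk Γ z := mem_RPblk_of hzbig hzZ hzb hE₁D hE₁big hE₁Z
  have hE₂RP : Ψ.sh E₂ ∈ Ψ.RPblk Γ z := mem_RPblk_of hzbig hzZ hzb hE₂D hE₂big hE₂Z
  -- `E₁`, `E₂` are over the sphere: predecessor / successor are over `B_{3n} ∖ D`
  have hch := hγO.chain
  rw [hγeq, List.isChain_append] at hch
  have hE₁S : Ψ.sh E₁ ∈ sqRing z 3 := by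
    set u := p₀.getLast hp₀ with hu
    have huE : s(u, E₁) ∈ ω := (hch.2.2 u (by simp [hu, List.getLast?_eq_some_getLast hp₀]) E₁ (by simp)).1
    have hup₀ : u ∈ p₀ := List.getLast_mem hp₀
    have huγ : u ∈ Ψ.γmin Γ ω := by rw [hγeq]; exact List.mem_append_left _ hup₀
    exact Ψ.sh_mem_sqRing_of_adj Γ z hE₁D (hadj huE).symm (hγO.subset u huγ) (hp₀D u hup₀)
  have hE₂S : Ψ.sh E₂ ∈ sqRing z 3 := by
    set u := s₀.head hs₀ with hu
    have h1 := hch.2.1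
    rw [List.isChain_cons] at h1
    have h3 := (List.isChain_append.1 (show (mid ++ E₂ :: s₀).IsChain _ from h1.2)).2.1
    rw [List.isChain_cons] at h3
    have hEu : s(E₂, u) ∈ ω := (h3.1 u (by simp [hu, List.head?_eq_some_head hs₀])).1
    have hus₀ : u ∈ s₀ := List.head_mem hs₀
    have huγ : u ∈ Ψ.γmin Γ ω := by rw [hγeq]; simp [hus₀]
    exact Ψ.sh_mem_sqRing_of_adj Γ z hE₂D (hadj hEu) (hγO.subset u huγ) (hs₀D u hus₀)
  -- the `src'`-side path `σ` and `w'`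
  obtain ⟨w', σ, hσhead, hw'D, hσchain, hσsmall, hσγ, hσD, hσsrc'⟩ :=
    Ψ.exists_sigma_of_mem_U' Γ hzU (D := D) fun q hq hqs => Ψ.sqBall_inter_small_subset_Dblk Γ z (sqBall_mono z (by norm_num) hq) hqs
  have hσne : σ ≠ [] := by rintro rfl; simp at hσhead
  have hw'σ : w' ∈ σ := by
    have : σ.head hσne = w' := by rw [List.head?_eq_some_head hσne, Option.some.injEq] at hσhead; exact hσhead
    rw [← this]; exact List.head_mem _
  have hw'γ : Ψ.sh w' ∉ Ψ.γcols Γ ω := hσγ w' hw'σ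
  have hw'z : Ψ.sh w' ≠ z := fun h => hw'γ ⟨g, hgγ, hgz.trans h.symm⟩
  have hw'E₁ : Ψ.sh w' ≠ Ψ.sh E₁ := fun h => hw'γ ⟨E₁, hE₁γ, h.symm⟩
  have hw'E₂ : Ψ.sh w' ≠ Ψ.sh E₂ := fun h => hw'γ ⟨E₂, hE₂γ, h.symm⟩
  -- the routing
  obtain ⟨htRD, hsRD⟩ := tR_le_tD (Ψ := Ψ) Γ z
  obtain ⟨r, hkey⟩ := Ψ.exists_routeData_of_localLinkage hL z htRD hsRD (three_le_tR_or_sR hX₂) hE₁₂ hE₁RP hE₁S hE₂RP hE₂S hw'D hw'z hw'E₁ hw'E₂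
  have hRPD : Ψ.RPblk Γ z ⊆ D := Ψ.RPblk_subset_Dblk Γ z
  have hRPbig : Ψ.RPblk Γ z ⊆ Ψ.big Γ := RPblk_subset_big hΓ hm hzbig hzs
  refine ⟨⟨D, p₀, E₁, mid, E₂, s₀, r.P, r.c, r.Br, σ, hDW, hγeq, hp₀, hs₀, hp₀D, hs₀D, hE₁D, hE₂D,
    fun x hx => hRPD (r.hP x hx), fun x hx => hRPbig (r.hP x hx), fun x hx => RPblk_disjoint_zSeg hzbig hzZ hzb (r.hP x hx),
    r.hchain, r.hnodup, r.c_mem, r.hBr, r.hBrD, r.hBrchain, r.hBrnodup, r.hBrSP, r.hfwd_of_key hkey, ?_, by rw [r.hBrlast]; exact hσhead,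
    hσchain, hσsmall, hσγ, hσD, hσsrc'⟩, hD3⟩
  -- no structure vertex over `S_{3n}`
  intro v hv hvsrc _
  rw [mem_lift] at hvsrc
  rcases List.mem_append.1 hv with h | h
  · exact absurd hvsrc (Dblk_disjoint_src hΓ hm hzs (hRPD (r.hP v h)))
  · exact absurd hvsrc (Dblk_disjoint_src hΓ hm hzs (r.hBrD v (List.dropLast_subset _ h)))

end SqShadow

end Summit.CriticalPhenomena.PercolationContinuityZ3.Theorems.Transplant

end
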